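import Summits.ResolutionOfSingularities.ResolutionOfSingularities.Theorems.ValuativeLuAlphaPTorsorDiscreteFreeRegime
import Mathlib.Algebra.CharP.Lemmas

/-!
# Discrete rank one in base dimension two: descent of discreteness and chart bookkeeping

Helper file for the E1 target `luAlphaPTorsor_dimTwo_of_discrete` of the line
`pfaff-line-log-final-forms` (crux `Valuative.LuAlphaPTorsor`, item
`stmt-ResolutionOfSingularities-0641`): the crux in base dimension two along every discrete
rank-one valuation. The K₀-internal layers L1–L4 (`…DiscreteFreeRegime`,
`…DiscreteInitialDerivation`, `…DiscreteDerivationChain`, `…DiscreteCleanBound`,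
`…DiscreteRounds`) are plumbed to the crux vocabulary by the assembly; this file supplies the
elementary pieces of that plumbing which live inside one valued field, all [folklore]:

* `isEquiv_valuation_comap_ringHom`, `valuation_comap_lt_one_iff_of_ringHom`, `valuation_comap_eq_zpow_iff_of_ringHom` — the
  valuation of the pulled-back valuation ring `O.comap ι` along a field embedding `ι : K' → K`
  is equivalent to `O.valuation ∘ ι`;
* `discrete_descent` — if every non-zero value of `K` is an integral power of `v(π)` and `K'`
  has a non-zero element of value `< 1`, then every non-zero value of `K'` is an integral power
  of `v(π₀)` for some `π₀ ∈ K'` (a non-trivial subgroup of an infinite cyclic group is cyclic: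
  least positive exponent and Euclidean division);
* `forall_pow_ne_of_not_mem_range` — `t ∉ ι(K')` and `ι a = t ^ p` imply that `a` is not a
  `p`-th power in `K'` (Frobenius is injective on the field `K`);
* `valuation_le_of_inv_not_mem` — non-units of a dominated subring have value `≤ v(π)`;
* `span_pair_eq_maximalIdeal_of_forall_nonunit`, `mem_span_range_pair_iff_not_isUnit` — "`𝔪 ⊆ (π, y)` element-wise" as an
  equality of ideals;
* `freeRegime_exchange` — the free `π`-chart regime persists when `π` is replaced by `π'` of
  the same value lying in `R i₀` with `(π', y i₀)` generating `𝔪_{i₀}`.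
-/

set_option linter.dupNamespace false

namespace Summit.ResolutionOfSingularities.ResolutionOfSingularities.Theorems.PfaffLine

open IsLocalRing Literature.AlgebraicGeometry.Resolution

section Comap

variable {K K' : Type} [Field K] [Field K']

/-- The valuation of `O.comap ι` is equivalent to `O.valuation ∘ ι` (both have valuation ring
`O.comap ι`). [folklore] -/
theorem isEquiv_valuation_comap_ringHom (ι : K' →+* K) (O : ValuationSubring K) :
    (O.valuation.comap ι).IsEquiv (O.comap ι).valuation := by
  rw [Valuation.isEquiv_iff_valuationSubring, ValuationSubring.valuationSubring_valuation]
  ext x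
  rw [Valuation.mem_valuationSubring_iff, Valuation.comap_apply, ValuationSubring.mem_comap,
    ValuationSubring.valuation_le_one_iff]

/-- `v'(z) < 1 ↔ v(ι z) < 1` for the pulled-back valuation ring. [folklore] -/
theorem valuation_comap_lt_one_iff_of_ringHom (ι : K' →+* K) (O : ValuationSubring K) (z : K') :
    (O.comap ι).valuation z < 1 ↔ O.valuation (ι z) < 1 := by
  rw [← (isEquiv_valuation_comap_ringHom ι O).lt_one_iff_lt_one, Valuation.comap_apply]

/-- `v'(z) = v'(w) ↔ v(ι z) = v(ι w)` for the pulled-back valuation ring. [folklore] -/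
theorem valuation_comap_eq_iff_of_ringHom (ι : K' →+* K) (O : ValuationSubring K) (z w : K') :
    (O.comap ι).valuation z = (O.comap ι).valuation w ↔
      O.valuation (ι z) = O.valuation (ι w) := by
  rw [← (isEquiv_valuation_comap_ringHom ι O).eq_iff, Valuation.comap_apply, Valuation.comap_apply]

/-- `v'(z) = v'(π) ^ n ↔ v(ι z) = v(ι π) ^ n` (`n : ℤ`) for the pulled-back valuation ring.
[folklore] -/
theorem valuation_comap_eq_zpow_iff_of_ringHom (ι : K' →+* K) (O : ValuationSubring K) (z π : K')
    (n : ℤ) :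
    (O.comap ι).valuation z = (O.comap ι).valuation π ^ n ↔
      O.valuation (ι z) = O.valuation (ι π) ^ n := by
  rw [← map_zpow₀, ← map_zpow₀, valuation_comap_eq_iff_of_ringHom, map_zpow₀]

/-- **Discreteness descends to subfields.** If every non-zero value of `K` is an integral
power of `v(π)` (`0 < v(π) < 1`) and the subfield `K'` (embedded by `ι`) contains a non-zero
element of value `< 1`, then every non-zero value of `K'` is an integral power of `v'(π₀)` for
some `π₀ ∈ K'` with `0 < v'(π₀) < 1`: take `π₀` with `v(ι π₀) = v(π) ^ d`, `d ≥ 1` least, and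
divide exponents by `d`. [folklore] -/
theorem discrete_descent :
    ∀ {K K' : Type} [Field K] [Field K'] (ι : K' →+* K) (O : ValuationSubring K) {π : K}, π ≠ 0 → O.valuation π < 1 → (∀ z : K, z ≠ 0 → ∃ n : ℤ, O.valuation z = O.valuation π ^ n) → ∀ {m : K'}, m ≠ 0 → (O.comap ι).valuation m < 1 → ∃ π₀ : K', π₀ ≠ 0 ∧ (O.comap ι).valuation π₀ < 1 ∧ ∀ z : K', z ≠ 0 → ∃ n : ℤ, (O.comap ι).valuation z = (O.comap ι).valuation π₀ ^ n := by
  intro K K' _ _ ι O π hπ0 hπ1 hdisc m hm0 hm1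
  classical
  have hγ0 : O.valuation π ≠ 0 := (Valuation.ne_zero_iff _).mpr hπ0
  have hγpos : 0 < O.valuation π := pos_iff_ne_zero.mpr hγ0
  -- positive exponents which are values of elements of `K'`
  have hP : ∃ d : ℕ, 0 < d ∧ ∃ z : K', z ≠ 0 ∧ O.valuation (ι z) = O.valuation π ^ (d : ℤ) := by
    obtain ⟨n, hn⟩ := hdisc (ι m) ((map_ne_zero ι).mpr hm0)
    have hm1' : O.valuation (ι m) < 1 := (valuation_comap_lt_one_iff_of_ringHom ι O m).mp hm1
    rw [hn] at hm1'
    have hnpos : 0 < n := (zpow_lt_one_iff_right_of_lt_one₀ hγpos hπ1).mp hm1'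
    refine ⟨n.toNat, by omega, m, hm0, ?_⟩
    rw [Int.toNat_of_nonneg hnpos.le]
    exact hn
  obtain ⟨hdpos, π₀, hπ₀0, hπ₀v⟩ := Nat.find_spec hP
  have hmin : ∀ r : ℕ, r < Nat.find hP →
      ¬ (0 < r ∧ ∃ z : K', z ≠ 0 ∧ O.valuation (ι z) = O.valuation π ^ (r : ℤ)) :=
    fun r hr => Nat.find_min hP hr
  set d : ℕ := Nat.find hP with hd
  refine ⟨π₀, hπ₀0, ?_, fun z hz0 => ?_⟩
  · rw [valuation_comap_lt_one_iff_of_ringHom, hπ₀v]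
    exact (zpow_lt_one_iff_right_of_lt_one₀ hγpos hπ1).mpr (by exact_mod_cast hdpos)
  · obtain ⟨n, hn⟩ := hdisc (ι z) ((map_ne_zero ι).mpr hz0)
    set q : ℤ := n / d with hq
    set r : ℤ := n % d with hr'
    have hdr : (d : ℤ) * q + r = n := Int.mul_ediv_add_emod n d
    have hr0 : 0 ≤ r := Int.emod_nonneg n (by exact_mod_cast hdpos.ne')
    have hrd : r < d := Int.emod_lt_of_pos n (by exact_mod_cast hdpos)
    rw [← hdr] at hn
    -- `u = z · (π₀ ^ q)⁻¹` has value `v(π) ^ r`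
    have hu : O.valuation (ι (z * (π₀ ^ q)⁻¹)) = O.valuation π ^ r := by
      rw [map_mul, map_inv₀, map_zpow₀, map_mul, map_inv₀, map_zpow₀, hn, hπ₀v, ← zpow_mul,
        zpow_add₀ hγ0, mul_comm (O.valuation π ^ ((d : ℤ) * q)),
        mul_inv_cancel_right₀ (zpow_ne_zero _ hγ0)]
    have hr : r = 0 := by
      by_contra hrne
      have hrpos : 0 < r := lt_of_le_of_ne hr0 (Ne.symm hrne)
      refine hmin r.toNat (by omega) ⟨by omega, z * (π₀ ^ q)⁻¹, ?_, ?_⟩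
      · exact mul_ne_zero hz0 (inv_ne_zero (zpow_ne_zero _ hπ₀0))
      · rw [hu, Int.toNat_of_nonneg hr0]
    refine ⟨q, ?_⟩
    rw [valuation_comap_eq_zpow_iff_of_ringHom, hn, hπ₀v, ← zpow_mul, hr, add_zero]

/-- **`a` is not a `p`-th power in `K'`** when `ι a = t ^ p` with `t ∉ ι(K')` (`char K = p`:
`z ^ p = a` would give `(ι z - t) ^ p = 0`). [folklore] -/
theorem forall_pow_ne_of_not_mem_range {p : ℕ} [Fact p.Prime] [CharP K p] (ι : K' →+* K)
    {t : K} (ht : t ∉ ι.range) {a : K'} (ha : ι a = t ^ p) : ∀ z : K', z ^ p ≠ a := by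
  intro z hz
  apply ht
  refine ⟨z, ?_⟩
  have h0 : (ι z - t) ^ p = 0 := by rw [sub_pow_char, ← map_pow, hz, ha, sub_self]
  exact sub_eq_zero.mp (pow_eq_zero_iff (Fact.out : p.Prime).ne_zero |>.mp h0)

end Comap

section Chart

variable {K : Type} [Field K]

/-- In the discrete setting, a non-unit of a subring dominated by `O` has value `≤ v(π)`.
[folklore] -/
theorem valuation_le_of_inv_not_mem {O : ValuationSubring K} {S : Subring K}
    (hSO : SubringDominates S O.toSubring) {π : K} (hπ1 : O.valuation π < 1)
    (hγ0 : O.valuation π ≠ 0)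
    (hdisc : ∀ z : K, z ≠ 0 → ∃ n : ℤ, O.valuation z = O.valuation π ^ n)
    {z : K} (hz : z ∈ S) (hzinv : z⁻¹ ∉ S) : O.valuation z ≤ O.valuation π :=
  DiscreteFree.valuation_le_of_lt_one hπ1 hγ0 hdisc (valuation_lt_one_of_subringDominates hSO hz hzinv)

/-- **`𝔪 = (π, y)` as ideals** from the element-wise statement: if `π, y` are non-units of the
local subring `S` and every non-unit is `a π + b y`, then `(π, y) = 𝔪_S`. [folklore] -/
theorem span_pair_eq_maximalIdeal_of_forall_nonunit {S : Subring K} [IsLocalRing S] {π y : K} (hπ : π ∈ S)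
    (hπinv : π⁻¹ ∉ S) (hy : y ∈ S) (hyinv : y⁻¹ ∉ S)
    (hgen : ∀ z : K, z ∈ S → z⁻¹ ∉ S → ∃ a ∈ S, ∃ b ∈ S, z = a * π + b * y) :
    Ideal.span {(⟨π, hπ⟩ : S), ⟨y, hy⟩} = maximalIdeal S := by
  refine le_antisymm (Ideal.span_le.mpr ?_) fun z hz => ?_
  · rintro x (rfl | rfl)
    · exact (mem_maximalIdeal_iff_inv_not_mem _).mpr (Or.inr hπinv)
    · exact (mem_maximalIdeal_iff_inv_not_mem _).mpr (Or.inr hyinv)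
  · rcases (mem_maximalIdeal_iff_inv_not_mem z).mp hz with hz0 | hzinv
    · rw [show z = 0 from Subtype.ext hz0]
      exact zero_mem _
    · obtain ⟨a, ha, b, hb, e⟩ := hgen z z.2 hzinv
      refine Ideal.mem_span_pair.mpr ⟨⟨a, ha⟩, ⟨b, hb⟩, Subtype.ext ?_⟩
      push_cast
      exact e.symm

/-- The `Fin 2`-indexed form of `span_pair_eq_maximalIdeal_of_forall_nonunit`: membership in
`span (range ![π, y])` is being a non-unit. [folklore] -/
theorem mem_span_range_pair_iff_not_isUnit {S : Subring K} [IsLocalRing S] {π y : K} (hπ : π ∈ S)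
    (hπinv : π⁻¹ ∉ S) (hy : y ∈ S) (hyinv : y⁻¹ ∉ S)
    (hgen : ∀ z : K, z ∈ S → z⁻¹ ∉ S → ∃ a ∈ S, ∃ b ∈ S, z = a * π + b * y) (z : S) :
    z ∈ Ideal.span (Set.range ![(⟨π, hπ⟩ : S), ⟨y, hy⟩]) ↔ ¬ IsUnit z := by
  rw [Matrix.range_cons_cons_empty, span_pair_eq_maximalIdeal_of_forall_nonunit hπ hπinv hy hyinv hgen,
    mem_maximalIdeal, mem_nonunits_iff]

/-- **Exchange of the chart element.** In the free `π`-chart regime from stage `i₀` of a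
sequence `R` of subrings dominated by `O` (monotone, `R i ≤ R (i+1)`), let `π' ∈ R i₀` have the
same value as `π` and let `(π', y i₀)` generate the non-units of `R i₀`. Then the free `π'`-chart
regime holds from `i₀` with the same `y`: `π/π'` is a unit of `R i` for `i > i₀`
(`π'/π ∈ R (i₀+1)` has value `1`). [folklore] -/
theorem freeRegime_exchange {O : ValuationSubring K} {R : ℕ → Subring K}
    (hdomO : ∀ i, SubringDominates (R i) O.toSubring) (hmono : Monotone R) {π π' : K} {i₀ : ℕ}
    {y : ℕ → K}
    (hfree : ∀ i : ℕ, i₀ ≤ i → π ∈ R i ∧ (∀ z : K, z ∈ R i → z⁻¹ ∉ R i → z / π ∈ R (i + 1)) ∧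
      (y i ∈ R i ∧ (y i)⁻¹ ∉ R i ∧
        ∀ z : K, z ∈ R i → z⁻¹ ∉ R i → ∃ a ∈ R i, ∃ b ∈ R i, z = a * π + b * y i))
    (hπ'R : π' ∈ R i₀) (hv : O.valuation π' = O.valuation π) (hπ1 : O.valuation π < 1)
    (hπ0 : π ≠ 0)
    (hgen₀ : ∀ z : K, z ∈ R i₀ → z⁻¹ ∉ R i₀ → ∃ a ∈ R i₀, ∃ b ∈ R i₀, z = a * π' + b * y i₀) :
    ∀ i : ℕ, i₀ ≤ i → π' ∈ R i ∧ (∀ z : K, z ∈ R i → z⁻¹ ∉ R i → z / π' ∈ R (i + 1)) ∧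
      (y i ∈ R i ∧ (y i)⁻¹ ∉ R i ∧
        ∀ z : K, z ∈ R i → z⁻¹ ∉ R i → ∃ a ∈ R i, ∃ b ∈ R i, z = a * π' + b * y i) := by
  have hγ0 : O.valuation π ≠ 0 := (Valuation.ne_zero_iff _).mpr hπ0
  have hπ'0 : π' ≠ 0 := (Valuation.ne_zero_iff _).mp (hv ▸ hγ0)
  have hπ'inv : π'⁻¹ ∉ R i₀ :=
    DiscreteFree.inv_not_mem_of_valuation_lt_one (hdomO i₀).1 (hv ▸ hπ1) (hv ▸ hγ0)
  -- `ρ = π'/π ∈ R (i₀+1)` is a unit there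
  have hρ : π' / π ∈ R (i₀ + 1) := (hfree i₀ le_rfl).2.1 π' hπ'R hπ'inv
  have hρv : O.valuation (π' / π) = 1 := by rw [map_div₀, hv, div_self hγ0]
  have hρinv : π / π' ∈ R (i₀ + 1) := by
    have h1 : (π' / π)⁻¹ ∈ O := by
      rw [← O.valuation_le_one_iff, map_inv₀, hρv, inv_one]
    have := (hdomO (i₀ + 1)).2 _ hρ h1
    rwa [inv_div] at this
  intro i hi
  obtain ⟨hπR, hdiv, hyR, hyinv, hgen⟩ := hfree i hi
  refine ⟨hmono hi hπ'R, fun z hz hzinv => ?_, hyR, hyinv, fun z hz hzinv => ?_⟩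
  · have e : z / π' = z / π * (π / π') := by field_simp
    rw [e]
    exact (R (i + 1)).mul_mem (hdiv z hz hzinv) (hmono (Nat.succ_le_succ hi) hρinv)
  · rcases hi.lt_or_eq with hlt | heq
    · obtain ⟨a, ha, b, hb, e⟩ := hgen z hz hzinv
      refine ⟨a * (π / π'), (R i).mul_mem ha (hmono (Nat.succ_le_of_lt hlt) hρinv), b, hb, ?_⟩
      rw [e]
      field_simp
    · subst heq
      exact hgen₀ z hz hzinv

end Chart

end Summit.ResolutionOfSingularities.ResolutionOfSingularities.Theorems.PfaffLine
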